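import Summits.BirchSwinnertonDyer.Rank1Residual.Supersingular.AnalyticRankZeroOfLOneBall
import Summits.BirchSwinnertonDyer.Rank1Residual.Supersingular.KuriharaTwistRoundingIntegrality
import Literature.NumberTheory.EllipticCurves.Rank1Residual.PeriodUnitProofs
import Literature.NumberTheory.EllipticCurves.LeadingTermPPartEisensteinProofs
import Literature.NumberTheory.EllipticCurves.AnomalousOfRationalTorsionProofs
import Literature.NumberTheory.EllipticCurves.Rank1Residual.Typed.X6
import Summits.BirchSwinnertonDyer.Rank1Residual.Additive.IntModelTamagawaCertificate
import HarnessLib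

/-!
# `#Ш_an(E) ∈ ℚ` AND ITS EXACT `p`-ADIC VALUATION FROM THE LEVEL-ONE ENCLOSURE `hball0` of `T₀ = L(E,1)/ω₁`:
# the CREMONA binders `r_an = 0`, `#Ш_an = q`, `ord_p q ≤ 2` of the rank-0 VISIBILITY offers discharged in the kernel

Cell `b2b-bsdres`, supersingular family, prover A = unit `b2b-bsdres-x10b` (gen 22).  Topic file; namespace
`Summit.BirchSwinnertonDyer.Rank1Residual.Supersingular`.  THEOREMS ONLY (no definition, no named fact, nothing
asserted about any curve, nothing booked); X6 / X7 stay CONSTRUCTION-SHAPED (RESIDUAL-MAP §I N4 / N5).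
Companion of `AnalyticRankZeroOfLOneBall.lean` (gen 21: `hball0 ⇒ L(E,1) ≠ 0 ⇒ r_an = 0`).

HONEST FRAMING (run/shared/lean/b2b/bsd-rank1-residual/, verbatim in every file): the goal of the
cell is to DELETE the COMBINATION-SHAPED residual classes of the Birch–Swinnerton-Dyer formula for
ALL analytic-rank `≤ 1` elliptic curves over `ℚ` — "full BSD formula for every rank `≤ 1` curve in
class `C`" assembled STRICTLY from published theorems — so that the rank-`≤ 1` remainder becomes
exactly the CONSTRUCTION-SHAPED classes, which are TYPED (missing-input `Prop`s), NOT attempted.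
This is not "finishing BSD".

## What this file proves

The rank-0 VISIBILITY offers (`X6VisibilityTamDefectShape` / `X7VisibilityShapeFiveKinds` and their records
`bsdp_x6r0vis[5]_…`, `bsdp_x7r0vis[5]_…`) take THREE data binders read off Cremona's `allbsd` table:
`hr0 : W.analyticRank = 0`, `hq : shaAn W = q` and `hv : padicValRat p q ≤ 2`.  All three follow from the
engine's level-ONE enclosure (the display of gen 21's `…RanL1Cert…` records)

`hball0 : ∃ mid rad, rad ≤ R ∧ |mid − I| ≤ Mr ∧ |den·(c_∞·(re L(E,1)/Ω⁺_f)) − mid| ≤ rad`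

(`I ∈ ℤ`, `den, c_∞ ∈ ℕ`; `T₀ = L(E,1)/ω₁ = I/den`), the newform `f` of `W` and PUBLISHED facts, by kernel arithmetic:

* `ratPlusSymbol_zero_eq_div_of_LOneBall` — **`[0]⁺_f = I/(den·c_∞)` EXACTLY**: `re L(E,1)/Ω⁺_f = [0]⁺_f`
  (`IsNewformOf.ratPlusSymbol_zero_mul_plusPeriod`, MTT §I.8), `den [0]⁺_f ∣ 2#Ẽ(𝔽_ℓ) ≤ 8ℓ` at any good prime `ℓ`
  (`den_sum_ratPlusSymbol_le`, Cremona (2.8.8)) and the ROUNDING LEMMA (`sum_ratPlusSymbol_eq_div_of_ball` with the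
  single cusp `0 = 0/1`): `8ℓ·(Mr + R) < 1` forces `den·c_∞·[0]⁺_f = I`.
* `entireLFunction_one_eq_of_LOneBall` — hence `L(E,1) = (I/(den·c_∞))·Ω⁺_f`.
* `exists_shaAn_eq_of_LOneBall_of_periodUnit` — the CORE: any prime `p` with `p ∤ #E(ℚ)_tors` and a period unit
  `Ω(W) = u·Ω⁺_f`, `|u|_p = 1` given as a hypothesis, the rounding done at any good prime `ℓ`; wrappers
  `exists_shaAn_eq_of_LOneBall` (good `p ≥ 5`, below), `…_three` (`p = 3`, `realPeriodRat_eq_unit_mul_plusPeriod_three`),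
  `…_of_multiplicative` (`p ∥ N`, `p ≥ 5`, `realPeriodRat_eq_unit_mul_plusPeriod_of_multiplicative`; rounding at a good `ℓ`).
* `exists_shaAn_eq_of_LOneBall` — **`#Ш_an ∈ ℚ` with its EXACT valuation**: for a globally minimal elliptic `W`,
  a good prime `p ≥ 5` with `E[p]` irreducible, the newform `f`, the period comparison
  `hϖ : realPeriodRat_eq_unit_mul_plusPeriod` (`Ω(W) = u·Ω⁺_f`, `|u|_p = 1`; Greenberg–Vatsal Rem. 3.4 + Manin constant)
  and GZK (`Reg = 1` in rank `0`): `#Ш_an = (I/(den c_∞))·#E(ℚ)_tors²/(u·∏c_ℓ)` and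
  `ord_p #Ш_an = v_p(I) − v_p(den·c_∞) − v_p(∏c_ℓ)` (`p ∤ #E(ℚ)_tors` by irreducibility:
  `not_hasIrreducibleModPGaloisRep_of_dvd_torsionOrder`; `ord_p u = 0`).
* `exists_shaAn_padicValRat_le_of_LOneBall` — **the consumer form**: if moreover `p^m ∣ den·c_∞·∏c_ℓ` and
  `p^{m+k+1} ∤ I` (two `decide`s once `∏c_ℓ` is a kernel numeral — Tate-algorithm row certificate,
  `IntModelTam.tamagawaProduct_eq_rowValueZ_of_intModel`), then `ord_p #Ш_an ≤ k`; together with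
  `analyticRank_eq_zero_of_LOneBall` this is exactly the triple `(hr0, hq, hv)` (`k = 2`).
* `analyticRank_shaAn_of_LOneBall_of_rowCheckZ` — **the record form**: good SUPERSINGULAR `p ≥ 5` (`GoodSS W p`, the first
  component of `ClassX6` / `ClassX7`; irreducibility is then Serre's theorem `hasIrreducibleModPGaloisRep_of_dvd_frobeniusTrace`),
  the integral model `W₀` of `W` and a kernel-sharpened Tate-algorithm ROW CERTIFICATE `(Es, Xs, Zs)` on `W₀`
  (`TamZ.rowCheckZ`, `rowExactZ`: `decide +kernel`) with `p^m ∣ den·c_∞·rowValueZ`, `p^(m+k+1) ∤ I` ⇒ the same triple.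

What stays OUTSIDE the kernel (said plainly, as in `KuriharaTwistRoundingIntegrality`): (a) the ball itself (Arb,
rigorous series tail for `L(E,1)`, AGM for `ω₁`, cross-checked against PARI: job evidence); (b) the identification of
the engine's `T₀ = L(E,1)/ω₁` with `c_∞·L(E,1)/Ω⁺_f`, i.e. `Ω⁺_f = c_∞·ω₁ = Ω(E)` (optimal curve, Manin constant `1`) —
the period-transfer binder every `hball0` / `hballL` consumer already displays.  Per pair; NOT a class theorem;
nothing booked.

References: B. Mazur, J. Tate, J. Teitelbaum, Invent. Math. 84 (1986) §I.8 [MazurTateTeitelbaum1986Invent];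
J. E. Cremona, *Algorithms for modular elliptic curves* (1997) §2.8 [CremonaAlgorithms1997]; R. Greenberg,
V. Vatsal, Invent. Math. 142 (2000) §3 Rem. 3.4 [GreenbergVatsal2000]; R. L. Miller, LMS J. Comput. Math. 14 (2011)
Def. 1.1 [Miller2011LMS]; B. Mazur, IHÉS 47 (1977) III §5 [Mazur1977]; B. Mazur, Invent. Math. 44 (1978) Cor. 4.1 [Mazur1978]; J.-P. Serre, Invent. Math. 15 (1972) §1.11
[Serre1972]; J. H. Silverman, *Advanced Topics* (1994) IV.9.4 [Silverman1994]; `AnalyticRankZeroOfLOneBall.lean` (gen 21);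
`Additive/IntModelTamagawaCertificate.lean` (n1011-p03).
-/

set_option autoImplicit false

noncomputable section

open scoped MatrixGroups ModularForm

open CongruenceSubgroup WeierstrassCurve Literature.NumberTheory.EllipticCurves
  Literature.NumberTheory.EllipticCurves.ModularForms
  Literature.NumberTheory.EllipticCurves.Rank1Residual
  Summit.BirchSwinnertonDyer.Rank1Residual.Supersingular.KuriharaTwist
  Summit.BirchSwinnertonDyer.BirchSwinnertonDyer.Rank2Observatory.Tam
  Summit.BirchSwinnertonDyer.Rank1Residual.Additive.IntModelTam

namespace Summit.BirchSwinnertonDyer.Rank1Residual.Supersingular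

variable {N : ℕ} [NeZero N] {f : CuspForm (Gamma0 N) 2}
  {W : WeierstrassCurve ℚ} [W.IsElliptic] [W.IsGloballyMinimal]

/-! ### §1 `[0]⁺_f = I/(den·c_∞)` exactly, from the level-one enclosure and the denominator lemma -/

/-- **`[0]⁺_f = I/(den·c_∞)` EXACTLY FROM THE LEVEL-ONE ENCLOSURE.**  For the newform `f` of `E = W`, a good prime
`ℓ`, naturals `den, c` with `den·c ≥ 1`, an integer `I` and reals `R, Mr` with `8ℓ·(Mr + R) < 1`: a ball
`|den·(c·(re L(E,1)/Ω⁺_f)) − mid| ≤ rad ≤ R` with `|mid − I| ≤ Mr` forces `[0]⁺_f = I/(den·c)`, because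
`re L(E,1)/Ω⁺_f = [0]⁺_f ∈ ℚ` has denominator `∣ 2#Ẽ(𝔽_ℓ) ≤ 8ℓ` (`sum_ratPlusSymbol_eq_div_of_ball`, single cusp
`0`). [cite: CremonaAlgorithms1997, §2.8 (2.8.8) (PDF p. 26)] [cite: MazurTateTeitelbaum1986Invent, §I.8 (8.6)] -/
theorem ratPlusSymbol_zero_eq_div_of_LOneBall (hf : IsNewformOf W f) {ℓ : ℕ} [Fact ℓ.Prime]
    (hgood : W.HasGoodReductionAtPrime ℓ) (R Mr : ℝ) (den c : ℕ) (hD : 0 < den * c) (I : ℤ)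
    (hsmall : 8 * (ℓ : ℝ) * (Mr + R) < 1)
    (hball0 : ∃ mid rad : ℝ, rad ≤ R ∧ |mid - ((I : ℤ) : ℝ)| ≤ Mr ∧
      |(den : ℝ) * ((c : ℝ) * ((W.entireLFunction 1).re / plusPeriod f)) - mid| ≤ rad) :
    ratPlusSymbol f 0 = (I : ℚ) / ((den * c : ℕ) : ℚ) := by
  obtain ⟨mid, rad, hrad, hmar, hball⟩ := hball0
  have hpos : 0 < plusPeriod f := IsNewform0.plusPeriod_pos_holds hf.1 hf.coeffField_eq_bot
  have hre : (W.entireLFunction 1).re / plusPeriod f = ((ratPlusSymbol f 0 : ℚ) : ℝ) := by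
    rw [← hf.ratPlusSymbol_zero_mul_plusPeriod, mul_div_cancel_right₀ _ hpos.ne']
  -- the single-cusp sum `Σ_{i ∈ univ : Finset Unit} 1 · [0/1]⁺_f = [0]⁺_f`
  have hsum : ∑ _i ∈ (Finset.univ : Finset Unit), ((1 : ℤ) : ℚ) * ratPlusSymbol f (((0 : ℤ) : ℚ) / (1 : ℕ)) =
      ratPlusSymbol f 0 := by
    simp
  have hball' : |((den * c : ℕ) : ℝ) *
      ((∑ _i ∈ (Finset.univ : Finset Unit), ((1 : ℤ) : ℚ) * ratPlusSymbol f (((0 : ℤ) : ℚ) / (1 : ℕ)) : ℚ) : ℝ) -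
        mid| ≤ rad := by
    rw [hsum, ← hre]
    push_cast
    rw [mul_assoc]
    exact hball
  have hcert : 8 * (ℓ : ℝ) * (Mr + rad) < 1 :=
    lt_of_le_of_lt (by nlinarith [(Fact.out : ℓ.Prime).pos, show (0:ℝ) ≤ 8 * (ℓ : ℝ) by positivity]) hsmall
  have h := sum_ratPlusSymbol_eq_div_of_ball hf hgood (n := 1) (Nat.coprime_one_left N)
    (Finset.univ : Finset Unit) (fun _ => (1 : ℤ)) (fun _ => (0 : ℤ)) hD (J := I) hball' hmar hcert
  rw [hsum] at h
  rw [h]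

/-- **`L(E,1) = (I/(den·c_∞))·Ω⁺_f`** under the hypotheses of `ratPlusSymbol_zero_eq_div_of_LOneBall`
(`IsNewformOf.entireLFunction_one_eq`: `L(E,1) = [0]⁺_f·Ω⁺_f`). [cite: MazurTateTeitelbaum1986Invent, §I.8 (8.6)] -/
theorem entireLFunction_one_eq_of_LOneBall (hf : IsNewformOf W f) {ℓ : ℕ} [Fact ℓ.Prime]
    (hgood : W.HasGoodReductionAtPrime ℓ) (R Mr : ℝ) (den c : ℕ) (hD : 0 < den * c) (I : ℤ)
    (hsmall : 8 * (ℓ : ℝ) * (Mr + R) < 1)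
    (hball0 : ∃ mid rad : ℝ, rad ≤ R ∧ |mid - ((I : ℤ) : ℝ)| ≤ Mr ∧
      |(den : ℝ) * ((c : ℝ) * ((W.entireLFunction 1).re / plusPeriod f)) - mid| ≤ rad) :
    W.entireLFunction 1 = ((((I : ℚ) / ((den * c : ℕ) : ℚ) : ℚ) : ℝ) * plusPeriod f : ℝ) := by
  rw [hf.entireLFunction_one_eq, ratPlusSymbol_zero_eq_div_of_LOneBall hf hgood R Mr den c hD I hsmall hball0]

/-! ### §2 `#Ш_an ∈ ℚ` and its exact `p`-adic valuation -/

/-- **CORE: `#Ш_an(E) ∈ ℚ` WITH ITS EXACT `p`-ADIC VALUATION, FROM THE LEVEL-ONE ENCLOSURE AND A PERIOD UNIT.**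
`W` globally minimal elliptic, `f` its newform, `p` any prime with `p ∤ #E(ℚ)_tors` and a rational `u` with
`|u|_p = 1`, `Ω(W) = u·Ω⁺_f` (the CONCLUSION of the period comparisons `realPeriodRat_eq_unit_mul_plusPeriod[_three |
_of_multiplicative]`), GZK (`hGZK`), and the enclosure `hball0` rounded at ANY good prime `ℓ` (`8ℓ·(Mr + R) < 1`) with
`I ≠ 0`.  Then `r_an = 0` (gen 21), `Reg = 1`, `L(E,1) = (I/(den c))·Ω⁺_f`, so `#Ш_an = (I/(den c))·#E(ℚ)_tors²/(u·∏c_ℓ) ∈ ℚ`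
and `ord_p #Ш_an = ord_p I − ord_p (den·c) − ord_p ∏c_ℓ`.  Per pair; nothing booked.
[cite: Miller2011LMS, §1 and Def. 1.1 (arXiv:1010.2431 p. 3)] [cite: GreenbergVatsal2000, §3, Remark 3.4]
[cite: MazurTateTeitelbaum1986Invent, §I.8 (8.6)] -/
theorem exists_shaAn_eq_of_LOneBall_of_periodUnit (hGZK : rank_eq_analyticRank_of_analyticRank_le_one)
    (W : WeierstrassCurve ℚ) [W.IsElliptic] [W.IsGloballyMinimal] (p : ℕ) [Fact p.Prime]
    (htors : ¬ p ∣ W.torsionOrder) {N : ℕ} [NeZero N] (f : CuspForm (Gamma0 N) 2) (hf : IsNewformOf W f)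
    {u : ℚ} (hu1 : ‖(u : ℚ_[p])‖ = 1) (hΩu : W.realPeriodRat = u * plusPeriod f)
    {ℓ : ℕ} [Fact ℓ.Prime] (hgood : W.HasGoodReductionAtPrime ℓ)
    (R Mr : ℝ) (den c : ℕ) (hD : 0 < den * c) (I : ℤ) (hI : I ≠ 0) (hsmall : 8 * (ℓ : ℝ) * (Mr + R) < 1)
    (hball0 : ∃ mid rad : ℝ, rad ≤ R ∧ |mid - ((I : ℤ) : ℝ)| ≤ Mr ∧
      |(den : ℝ) * ((c : ℝ) * ((W.entireLFunction 1).re / plusPeriod f)) - mid| ≤ rad) :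
    ∃ q : ℚ, shaAn W = (q : ℂ) ∧
      padicValRat p q = padicValInt p I - padicValNat p (den * c) - padicValNat p W.tamagawaProduct := by
  have hℓP : ℓ.Prime := Fact.out
  -- r_an = 0 (gen 21), rank 0, Reg = 1
  have hR1 : R + Mr < 1 := by
    have h1 : (1 : ℝ) ≤ ℓ := by exact_mod_cast hℓP.one_lt.le
    by_cases h0 : 0 ≤ Mr + R
    · nlinarith
    · linarith
  have hr : W.analyticRank = 0 := analyticRank_eq_zero_of_LOneBall f R Mr den c I hI hR1 hball0
  obtain ⟨hrank, hfin⟩ := hGZK W (by omega)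
  have hr0 : W.mordellWeilRank = 0 := hrank.trans hr
  have hReg : W.regulator = 1 := W.regulator_eq_one_of_rank_zero hr0
  -- the period unit
  have hvu : padicValRat p u = 0 := padicValRat_eq_zero_of_norm_ratCast_eq_one hu1
  have hu0 : u ≠ 0 := by
    rintro rfl
    simp at hu1
  have hΩpos : 0 < plusPeriod f := IsNewform0.plusPeriod_pos_holds hf.1 hf.coeffField_eq_bot
  -- L(E,1) = x Ω⁺_f with x = I/(den c)
  set x : ℚ := (I : ℚ) / ((den * c : ℕ) : ℚ) with hx
  have hL1 : W.entireLFunction 1 = (((x : ℚ) : ℝ) * plusPeriod f : ℝ) :=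
    entireLFunction_one_eq_of_LOneBall hf hgood R Mr den c hD I hsmall hball0
  have hT : 0 < W.torsionOrder := W.torsionOrder_pos_holds
  have hcT : 0 < W.tamagawaProduct := W.tamagawaProduct_pos'
  have hDq : ((den * c : ℕ) : ℚ) ≠ 0 := by exact_mod_cast hD.ne'
  have hx0 : x ≠ 0 := div_ne_zero (by exact_mod_cast hI) hDq
  -- #Ш_an = x tors² / (u ∏c)
  set q : ℚ := x * (W.torsionOrder : ℚ) ^ 2 / (u * (W.tamagawaProduct : ℚ)) with hq
  have hsha : shaAn W = ((q : ℚ) : ℂ) := by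
    rw [shaAn_def, W.leadingLCoeff_eq_of_analyticRank_eq_zero hr, hL1, hReg, hΩu, hq]
    have hcC : ((W.tamagawaProduct : ℚ) : ℂ) ≠ 0 := by exact_mod_cast hcT.ne'
    have huC : ((u : ℚ) : ℂ) ≠ 0 := by exact_mod_cast hu0
    have hΩC : ((plusPeriod f : ℝ) : ℂ) ≠ 0 := Complex.ofReal_ne_zero.mpr hΩpos.ne'
    push_cast
    field_simp
  refine ⟨q, hsha, ?_⟩
  have hT0 : (W.torsionOrder : ℚ) ≠ 0 := by exact_mod_cast hT.ne'
  have hc0 : (W.tamagawaProduct : ℚ) ≠ 0 := by exact_mod_cast hcT.ne'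
  have htors0 : padicValNat p W.torsionOrder = 0 := by
    rw [padicValNat.eq_zero_iff]
    exact Or.inr (Or.inr htors)
  have hvx : padicValRat p x = padicValInt p I - padicValNat p (den * c) := by
    rw [hx, padicValRat.div (by exact_mod_cast hI) hDq, padicValRat.of_int, padicValRat.of_nat]
  have hvT : padicValRat p ((W.torsionOrder : ℚ) ^ 2) = 0 := by
    rw [padicValRat.pow, padicValRat.of_nat, htors0]
    simp
  have hvuc : padicValRat p (u * (W.tamagawaProduct : ℚ)) = padicValNat p W.tamagawaProduct := by
    rw [padicValRat.mul hu0 hc0, hvu, padicValRat.of_nat, zero_add]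
  rw [hq, padicValRat.div (mul_ne_zero hx0 (pow_ne_zero 2 hT0)) (mul_ne_zero hu0 hc0),
    padicValRat.mul hx0 (pow_ne_zero 2 hT0), hvx, hvT, hvuc]
  ring

/-- **`#Ш_an(E) ∈ ℚ` WITH ITS EXACT `p`-ADIC VALUATION AT A GOOD PRIME `p ≥ 5` WITH `E[p]` IRREDUCIBLE** (the visibility /
Kurihara setting): the core theorem with the period comparison `hϖ : realPeriodRat_eq_unit_mul_plusPeriod`
(`Ω(W) = u·Ω⁺_f`, `|u|_p = 1`; Greenberg–Vatsal Rem. 3.4 + Manin constant), `p ∤ #E(ℚ)_tors` by irreducibility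
(`not_hasIrreducibleModPGaloisRep_of_dvd_torsionOrder`) and the rounding at `ℓ = p` itself.  Per pair; nothing booked.
[cite: Miller2011LMS, §1 and Def. 1.1 (arXiv:1010.2431 p. 3)] [cite: GreenbergVatsal2000, §3, Remark 3.4]
[cite: MazurTateTeitelbaum1986Invent, §I.8 (8.6)] [cite: Mazur1977, Ch. III §5, p. 157] -/
theorem exists_shaAn_eq_of_LOneBall (hϖ : realPeriodRat_eq_unit_mul_plusPeriod)
    (hGZK : rank_eq_analyticRank_of_analyticRank_le_one)
    (W : WeierstrassCurve ℚ) [W.IsElliptic] [W.IsGloballyMinimal] (p : ℕ) [Fact p.Prime] (hp : 5 ≤ p)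
    (hgood : W.HasGoodReductionAtPrime p) (hirr : W.HasIrreducibleModPGaloisRep p)
    {N : ℕ} [NeZero N] (f : CuspForm (Gamma0 N) 2) (hf : IsNewformOf W f)
    (R Mr : ℝ) (den c : ℕ) (hD : 0 < den * c) (I : ℤ) (hI : I ≠ 0) (hsmall : 8 * (p : ℝ) * (Mr + R) < 1)
    (hball0 : ∃ mid rad : ℝ, rad ≤ R ∧ |mid - ((I : ℤ) : ℝ)| ≤ Mr ∧
      |(den : ℝ) * ((c : ℝ) * ((W.entireLFunction 1).re / plusPeriod f)) - mid| ≤ rad) :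
    ∃ q : ℚ, shaAn W = (q : ℂ) ∧
      padicValRat p q = padicValInt p I - padicValNat p (den * c) - padicValNat p W.tamagawaProduct := by
  obtain ⟨u, hu1, hΩu⟩ := hϖ W p hp hgood hirr f hf
  exact exists_shaAn_eq_of_LOneBall_of_periodUnit hGZK W p
    (fun h ↦ not_hasIrreducibleModPGaloisRep_of_dvd_torsionOrder W p h hirr) f hf hu1 hΩu hgood R Mr den c hD I
    hI hsmall hball0

/-- **The same at `p = 3`** (good reduction at `3`, `E[3]` irreducible): the core theorem with the period comparison
`h3per : realPeriodRat_eq_unit_mul_plusPeriod_three` (Greenberg–Vatsal Rem. 3.4 + Mazur's Manin-constant corollary at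
`p = 3 ∤ N`) — for prover B's `p = 3` records (X6@3 / X7@3 / X8) that display `r_an = 0`, `#Ш_an = q`.  Per pair;
nothing booked. [cite: GreenbergVatsal2000, §3, Remark 3.4] [cite: Mazur1978, Cor. 4.1]
[cite: Miller2011LMS, §1 and Def. 1.1 (arXiv:1010.2431 p. 3)] -/
theorem exists_shaAn_eq_of_LOneBall_three (h3per : realPeriodRat_eq_unit_mul_plusPeriod_three)
    (hGZK : rank_eq_analyticRank_of_analyticRank_le_one)
    (W : WeierstrassCurve ℚ) [W.IsElliptic] [W.IsGloballyMinimal] [Fact (Nat.Prime 3)]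
    (hgood : W.HasGoodReductionAtPrime 3) (hirr : W.HasIrreducibleModPGaloisRep 3)
    {N : ℕ} [NeZero N] (f : CuspForm (Gamma0 N) 2) (hf : IsNewformOf W f)
    (R Mr : ℝ) (den c : ℕ) (hD : 0 < den * c) (I : ℤ) (hI : I ≠ 0) (hsmall : 8 * (3 : ℝ) * (Mr + R) < 1)
    (hball0 : ∃ mid rad : ℝ, rad ≤ R ∧ |mid - ((I : ℤ) : ℝ)| ≤ Mr ∧
      |(den : ℝ) * ((c : ℝ) * ((W.entireLFunction 1).re / plusPeriod f)) - mid| ≤ rad) :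
    ∃ q : ℚ, shaAn W = (q : ℂ) ∧
      padicValRat 3 q = padicValInt 3 I - padicValNat 3 (den * c) - padicValNat 3 W.tamagawaProduct := by
  obtain ⟨u, hu1, hΩu⟩ := h3per W hgood hirr f hf
  exact exists_shaAn_eq_of_LOneBall_of_periodUnit hGZK W 3
    (fun h ↦ not_hasIrreducibleModPGaloisRep_of_dvd_torsionOrder W 3 h hirr) f hf hu1 hΩu hgood R Mr den c hD I
    hI (by exact_mod_cast hsmall) hball0

/-- **The same at a MULTIPLICATIVE prime `p ≥ 5` with `E[p]` irreducible** (class X11's rank-0 records): the core theorem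
with the period comparison `hmult : realPeriodRat_eq_unit_mul_plusPeriod_of_multiplicative` (Greenberg–Vatsal Rem. 3.4 +
Mazur's corollary at `p ∥ N`), the rounding done at an auxiliary GOOD prime `ℓ` (`8ℓ·(Mr + R) < 1`; the denominator
lemma needs good reduction).  Per pair; nothing booked. [cite: GreenbergVatsal2000, §3, Remark 3.4] [cite: Mazur1978, Cor. 4.1]
[cite: Miller2011LMS, §1 and Def. 1.1 (arXiv:1010.2431 p. 3)] -/
theorem exists_shaAn_eq_of_LOneBall_of_multiplicative (hmult : realPeriodRat_eq_unit_mul_plusPeriod_of_multiplicative)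
    (hGZK : rank_eq_analyticRank_of_analyticRank_le_one)
    (W : WeierstrassCurve ℚ) [W.IsElliptic] [W.IsGloballyMinimal] (p : ℕ) [Fact p.Prime] (hp : 5 ≤ p)
    (hmul : W.HasMultiplicativeReductionAtPrime p) (hirr : W.HasIrreducibleModPGaloisRep p)
    {N : ℕ} [NeZero N] (f : CuspForm (Gamma0 N) 2) (hf : IsNewformOf W f)
    {ℓ : ℕ} [Fact ℓ.Prime] (hgood : W.HasGoodReductionAtPrime ℓ)
    (R Mr : ℝ) (den c : ℕ) (hD : 0 < den * c) (I : ℤ) (hI : I ≠ 0) (hsmall : 8 * (ℓ : ℝ) * (Mr + R) < 1)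
    (hball0 : ∃ mid rad : ℝ, rad ≤ R ∧ |mid - ((I : ℤ) : ℝ)| ≤ Mr ∧
      |(den : ℝ) * ((c : ℝ) * ((W.entireLFunction 1).re / plusPeriod f)) - mid| ≤ rad) :
    ∃ q : ℚ, shaAn W = (q : ℂ) ∧
      padicValRat p q = padicValInt p I - padicValNat p (den * c) - padicValNat p W.tamagawaProduct := by
  obtain ⟨u, hu1, hΩu⟩ := hmult W p hp hmul hirr f hf
  exact exists_shaAn_eq_of_LOneBall_of_periodUnit hGZK W p
    (fun h ↦ not_hasIrreducibleModPGaloisRep_of_dvd_torsionOrder W p h hirr) f hf hu1 hΩu hgood R Mr den c hD I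
    hI hsmall hball0

/-! ### §3 The consumer form: `r_an = 0`, `#Ш_an = q`, `ord_p q ≤ k` -/

/-- **THE THREE CREMONA BINDERS OF A RANK-0 VISIBILITY OFFER, DISCHARGED.**  Under the hypotheses of
`exists_shaAn_eq_of_LOneBall`, if `p^m ∣ den·c·∏c_ℓ(W)` and `p^(m+k+1) ∤ I` (both `decide` once `∏c_ℓ` is the
kernel numeral of a Tate-algorithm row certificate), then `r_an(W) = 0` and `#Ш_an(W) = q ∈ ℚ` with `ord_p q ≤ k`
(`ord_p q = ord_p I − ord_p(den c) − ord_p ∏c ≤ (m + k) − m`).  With `k = 2` these are exactly the binders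
`hr0`, `hq`, `hv` of `X6RankZero.bsdp_of_casselsTate_of_congr_of_places₄/₅` and
`X7RankZero.bsdp_of_casselsTate_of_congr_of_places₅_of_surj`.  Per pair; nothing booked.
[cite: Miller2011LMS, §1 and Def. 1.1 (arXiv:1010.2431 p. 3)] [cite: GreenbergVatsal2000, §3, Remark 3.4] -/
theorem exists_shaAn_padicValRat_le_of_LOneBall (hϖ : realPeriodRat_eq_unit_mul_plusPeriod)
    (hGZK : rank_eq_analyticRank_of_analyticRank_le_one)
    (W : WeierstrassCurve ℚ) [W.IsElliptic] [W.IsGloballyMinimal] (p : ℕ) [Fact p.Prime] (hp : 5 ≤ p)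
    (hgood : W.HasGoodReductionAtPrime p) (hirr : W.HasIrreducibleModPGaloisRep p)
    {N : ℕ} [NeZero N] (f : CuspForm (Gamma0 N) 2) (hf : IsNewformOf W f)
    (R Mr : ℝ) (den c : ℕ) (hD : 0 < den * c) (I : ℤ) (hsmall : 8 * (p : ℝ) * (Mr + R) < 1)
    (hball0 : ∃ mid rad : ℝ, rad ≤ R ∧ |mid - ((I : ℤ) : ℝ)| ≤ Mr ∧
      |(den : ℝ) * ((c : ℝ) * ((W.entireLFunction 1).re / plusPeriod f)) - mid| ≤ rad)
    (m k : ℕ) (hm : p ^ m ∣ den * c * W.tamagawaProduct) (hk : ¬ (p : ℤ) ^ (m + k + 1) ∣ I) :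
    W.analyticRank = 0 ∧ ∃ q : ℚ, shaAn W = (q : ℂ) ∧ padicValRat p q ≤ k := by
  have hpP : p.Prime := Fact.out
  have hI : I ≠ 0 := by
    rintro rfl
    exact hk (dvd_zero _)
  have hR1 : R + Mr < 1 := by
    have h1 : (1 : ℝ) ≤ p := by exact_mod_cast hpP.one_lt.le
    by_cases h0 : 0 ≤ Mr + R
    · nlinarith
    · linarith
  refine ⟨analyticRank_eq_zero_of_LOneBall f R Mr den c I hI hR1 hball0, ?_⟩
  obtain ⟨q, hq, hv⟩ :=
    exists_shaAn_eq_of_LOneBall hϖ hGZK W p hp hgood hirr f hf R Mr den c hD I hI hsmall hball0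
  refine ⟨q, hq, ?_⟩
  have hcT : 0 < W.tamagawaProduct := W.tamagawaProduct_pos'
  have hprod : 0 < den * c * W.tamagawaProduct := Nat.mul_pos hD hcT
  -- `m ≤ v_p(den c) + v_p(∏c)` and `v_p(I) ≤ m + k`
  have h1 : m ≤ padicValNat p (den * c) + padicValNat p W.tamagawaProduct := by
    have := (padicValNat_dvd_iff_le hprod.ne').mp hm
    rwa [padicValNat.mul hD.ne' hcT.ne'] at this
  have h2 : padicValInt p I ≤ m + k := by
    by_contra hlt
    rw [not_le] at hlt
    exact hk ((padicValInt_dvd_iff _ _).mpr (Or.inr (by omega)))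
  rw [hv]
  push_cast
  have h1' : (m : ℤ) ≤ (padicValNat p (den * c) : ℤ) + (padicValNat p W.tamagawaProduct : ℤ) := by
    exact_mod_cast h1
  have h2' : (padicValInt p I : ℤ) ≤ (m : ℤ) + (k : ℤ) := by exact_mod_cast h2
  linarith

/-! ### §4 The record form: good supersingular `p ≥ 5`, integral model, Tate-algorithm row certificate -/

/-- **THE RECORD FORM (good supersingular `p ≥ 5`).**  For a globally minimal elliptic `W/ℚ` with good SUPERSINGULAR
reduction at `p ≥ 5` (`GoodSS W p` — so `E[p]` is irreducible, Serre 1972 §1.11: tree theorem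
`hasIrreducibleModPGaloisRep_of_dvd_frobeniusTrace`), its newform `f`, the named facts `hϖ`, `hGZK`, the level-one
enclosure `hball0` (`8p·(Mr + R) < 1`), the integral model `W₀` of `W` with a kernel-sharpened Tate-algorithm ROW
CERTIFICATE `(Es, Xs, Zs)` (`∏c_ℓ(W) = rowValueZ Es Xs Zs`, `IntModelTam.tamagawaProduct_eq_rowValueZ_of_intModel`), and
naturals `m, k` with `p^m ∣ den·c·rowValueZ` and `p^(m+k+1) ∤ I`: `r_an(W) = 0` and `#Ш_an(W) = q ∈ ℚ` with `ord_p q ≤ k`.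
Every side condition is a `decide`; the records use `k = 2`.  Per pair; nothing booked.
[cite: Miller2011LMS, §1 and Def. 1.1 (arXiv:1010.2431 p. 3)] [cite: Serre1972, §1.11 Prop. 12] [cite: Silverman1994, IV.9.4]
[cite: GreenbergVatsal2000, §3, Remark 3.4] -/
theorem analyticRank_shaAn_of_LOneBall_of_rowCheckZ (hϖ : realPeriodRat_eq_unit_mul_plusPeriod)
    (hGZK : rank_eq_analyticRank_of_analyticRank_le_one)
    (W : WeierstrassCurve ℚ) [W.IsElliptic] [W.IsGloballyMinimal] (p : ℕ) [Fact p.Prime] (hp : 5 ≤ p)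
    (hss : GoodSS W p) {N : ℕ} [NeZero N] (f : CuspForm (Gamma0 N) 2) (hf : IsNewformOf W f)
    (R Mr : ℝ) (den c : ℕ) (hD : 0 < den * c) (I : ℤ) (hsmall : 8 * (p : ℝ) * (Mr + R) < 1)
    (hball0 : ∃ mid rad : ℝ, rad ≤ R ∧ |mid - ((I : ℤ) : ℝ)| ≤ Mr ∧
      |(den : ℝ) * ((c : ℝ) * ((W.entireLFunction 1).re / plusPeriod f)) - mid| ≤ rad)
    {W₀ : WeierstrassCurve ℤ} (hIW : integralModelInt W = W₀) {Es : List TamLocal} {Xs : List TamX}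
    {Zs : List TamZ} (hrow : TamZ.rowCheckZ Es Xs Zs W₀ = true) (hx : TamZ.rowExactZ Es Xs Zs = true)
    (m k : ℕ) (hm : p ^ m ∣ den * c * TamZ.rowValueZ Es Xs Zs) (hk : ¬ (p : ℤ) ^ (m + k + 1) ∣ I) :
    W.analyticRank = 0 ∧ ∃ q : ℚ, shaAn W = (q : ℂ) ∧ padicValRat p q ≤ k := by
  have hp2 : p ≠ 2 := by omega
  have hirr : W.HasIrreducibleModPGaloisRep p :=
    hasIrreducibleModPGaloisRep_of_dvd_frobeniusTrace W p hp2
      (W.not_dvd_minimalDiscriminantInt_of_hasGoodReductionAtPrime' p hss.1) hss.2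
  have hT : W.tamagawaProduct = TamZ.rowValueZ Es Xs Zs := tamagawaProduct_eq_rowValueZ_of_intModel hIW hrow hx
  exact exists_shaAn_padicValRat_le_of_LOneBall hϖ hGZK W p hp hss.1 hirr f hf R Mr den c hD I hsmall hball0 m k
    (by rw [hT]; exact hm) hk

end Summit.BirchSwinnertonDyer.Rank1Residual.Supersingular

end
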